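/-
[OURS · L1 W4.5(b) · EL♮(3)] SPECIMEN-TC⁺ (quartic, one inner step (i)) — local algebra α3: the two smooth charts of the inner point step.
-/
import Summits.ResolutionOfSingularities.ResolutionOfSingularities.Theorems.EquisingularLiftEquisingularLiftNatSpecimenQuarticLineStep
import Summits.ResolutionOfSingularities.ResolutionOfSingularities.Theorems.EquisingularLiftEquisingularLiftNatSpecimenQuarticTcDeltaLocalCharts
import HarnessLib

/-!
# [OURS · L1 W4.5(b) · EL♮(3)] SPECIMEN-TC⁺ for the quartic — INNER STEP (i) LOCAL ALGEBRA, part α3: the two smooth charts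
# (crux `EquisingularLiftNatThree` = stmt-ResolutionOfSingularities-20148; res-L1-w45b-lead-2 DEALS (D2) 2026-08-27T11:55:26Z «NON-VACUITY
# CERTIFICATES TC⁺»; scoping memo D/res-D-pv-034/SPECIMEN-TCPLUS-SCOPE.md §1; helper, closes nothing)

HONEST FRAMING. OURS (cell `res-hironaka`, chain w45b, slot W4.5(b)); NOT a statement of any manuscript; AI-written, weaker than expert review.

The cheapest non-vacuity certificate for the registered TC⁺ text uses the quartic `V(x₀²x₃² + x₁⁴ + x₂⁴)` with ONE inner step of type (i): blow
up the regular carrier point `(0,0,0)` of the line `Z₁ = V(ȳ₁, ȳ₂)` (`cenL`) inside the `x`-chart `Spec DL`, `DL = k[y₀,y₁,y₂]/(y₂² + y₁²(1 + y₀⁴))`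
(`…TcDeltaLocalCharts.gL`). Of the three charts of that point blow-up, the `y₀`-chart reproduces `gL` (self-similar; part α1), and the other
two carry the SMOOTH surfaces proved regular here by the Jacobian criterion in derivation form (stub-4's `isRegularRing_quotient_of_derivations`,
Stacks 07PF), `char k ≠ 2`:
* `y₁`-chart (`y₀ = y₁a`, `y₂ = y₁t`): strict transform `t² + 1 + y₁⁴a⁴` — `isRegularRing_quotient_innerChart₁`;
* `y₂`-chart (`y₀ = y₂a`, `y₁ = y₂b`): strict transform `1 + b²(1 + y₂⁴a⁴)` — `isRegularRing_quotient_innerChart₂`.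

References: Stacks 07PF; Hartshorne II Ex. 3.2.6 (context).
-/

set_option linter.dupNamespace false -- mandated namespace `Summit.<Summit>.<Problem>` of this single-conjunct summit

noncomputable section

open MvPolynomial
open Literature.AlgebraicGeometry.Resolution
open Summit.ResolutionOfSingularities.ResolutionOfSingularities.Theorems.EquisingularLift

namespace Summit.ResolutionOfSingularities.ResolutionOfSingularities.Cruxes.EquisingularLiftNat.Sections

namespace SpecimenQuarticTcPlus

variable (k : Type) [Field k]

/-- The strict transform on the `y₁`-chart of the inner step: `t² + 1 + y₁⁴a⁴` in `k[a, y₁, t] = k[X₀, X₁, X₂]`. [folklore] -/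
abbrev gInner₁ : MvPolynomial (Fin 3) k := X 2 ^ 2 + 1 + X 1 ^ 4 * X 0 ^ 4

/-- The strict transform on the `y₂`-chart of the inner step: `1 + b²(1 + y₂⁴a⁴)` in `k[a, b, y₂] = k[X₀, X₁, X₂]`. [folklore] -/
abbrev gInner₂ : MvPolynomial (Fin 3) k := 1 + X 1 ^ 2 * (1 + X 2 ^ 4 * X 0 ^ 4)

/-- **The `y₁`-chart of the inner step is smooth**: `k[a, y₁, t]/(t² + 1 + y₁⁴a⁴)` is a regular ring (`char k ≠ 2`): at a prime `Q ∋ g`,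
`∂_t g = 2t` and `∂_{y₁} g = 4y₁³a⁴` cannot both lie in `Q` (else `t², y₁⁴a⁴ ∈ Q` and `1 = g − t·t − y₁⁴a⁴ ∈ Q`).
[OURS · SPECIMEN-TC⁺ α3] [cite: StacksProject, Tag 07PF] -/
theorem isRegularRing_quotient_innerChart₁ (h2 : IsUnit (2 : k)) :
    IsRegularRing (MvPolynomial (Fin 3) k ⧸ Ideal.span {gInner₁ k}) := by
  refine SpecimenQuartic.isRegularRing_quotient_of_derivations (S₀ := k) _ fun Q hQ hqQ => ?_
  have h2A : IsUnit (2 : MvPolynomial (Fin 3) k) := SpecimenQuartic.isUnit_two_of k h2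
  by_contra hnone
  simp only [not_exists, not_not] at hnone
  have ht := hnone (pderiv 2)
  have hy := hnone (pderiv 1)
  have hdt : (pderiv 2 : Derivation k (MvPolynomial (Fin 3) k) _) (gInner₁ k) = 2 * X 2 := by
    simp [gInner₁, Derivation.leibniz, Derivation.leibniz_pow]
  have hdy : (pderiv 1 : Derivation k (MvPolynomial (Fin 3) k) _) (gInner₁ k) = 4 * (X 1 ^ 3 * X 0 ^ 4) := by
    simp [gInner₁, Derivation.leibniz, Derivation.leibniz_pow]
    ring
  rw [hdt] at ht
  rw [hdy] at hy
  have ht' : (X 2 : MvPolynomial (Fin 3) k) ∈ Q := SpecimenQuartic.mem_of_two_mul_mem hQ h2A ht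
  have hy' : (X 1 ^ 3 * X 0 ^ 4 : MvPolynomial (Fin 3) k) ∈ Q := SpecimenQuartic.mem_of_four_mul_mem hQ h2A hy
  have h1 : (1 : MvPolynomial (Fin 3) k) = gInner₁ k - X 2 * X 2 - X 1 * (X 1 ^ 3 * X 0 ^ 4) := by
    simp only [gInner₁]; ring
  have : (1 : MvPolynomial (Fin 3) k) ∈ Q := by
    rw [h1]
    exact Q.sub_mem (Q.sub_mem hqQ (Q.mul_mem_left _ ht')) (Q.mul_mem_left _ hy')
  exact hQ.ne_top ((Ideal.eq_top_iff_one _).mpr this)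

/-- **The `y₂`-chart of the inner step is smooth**: `k[a, b, y₂]/(1 + b²(1 + y₂⁴a⁴))` is a regular ring (`char k ≠ 2`): at a prime `Q ∋ g`,
`∂_b g = 2b(1 + y₂⁴a⁴) ∉ Q` (else `b²(1 + y₂⁴a⁴) ∈ Q` and `1 = g − b²(1 + y₂⁴a⁴) ∈ Q`).
[OURS · SPECIMEN-TC⁺ α3] [cite: StacksProject, Tag 07PF] -/
theorem isRegularRing_quotient_innerChart₂ (h2 : IsUnit (2 : k)) :
    IsRegularRing (MvPolynomial (Fin 3) k ⧸ Ideal.span {gInner₂ k}) := by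
  refine SpecimenQuartic.isRegularRing_quotient_of_derivations (S₀ := k) _ fun Q hQ hqQ => ?_
  have h2A : IsUnit (2 : MvPolynomial (Fin 3) k) := SpecimenQuartic.isUnit_two_of k h2
  refine ⟨pderiv 1, fun hb => ?_⟩
  have hdb : (pderiv 1 : Derivation k (MvPolynomial (Fin 3) k) _) (gInner₂ k) = 2 * (X 1 * (1 + X 2 ^ 4 * X 0 ^ 4)) := by
    simp [gInner₂, Derivation.leibniz, Derivation.leibniz_pow]
    ring
  rw [hdb] at hb
  have hb' : (X 1 * (1 + X 2 ^ 4 * X 0 ^ 4) : MvPolynomial (Fin 3) k) ∈ Q := SpecimenQuartic.mem_of_two_mul_mem hQ h2A hb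
  have h1 : (1 : MvPolynomial (Fin 3) k) = gInner₂ k - X 1 * (X 1 * (1 + X 2 ^ 4 * X 0 ^ 4)) := by
    simp only [gInner₂]; ring
  have : (1 : MvPolynomial (Fin 3) k) ∈ Q := by
    rw [h1]
    exact Q.sub_mem hqQ (Q.mul_mem_left _ hb')
  exact hQ.ne_top ((Ideal.eq_top_iff_one _).mpr this)


/-! ## α1: the `y₀`-chart of the inner step is self-similar: `DL[𝔪₀/ȳ₀] ≅ DL` with generators tracked -/

open SpecimenQuarticTcDelta

/-- The maximal ideal `𝔪₀ = (ȳ₀, ȳ₁, ȳ₂) ⊂ DL` of the inner point (the origin of the carrier line). [folklore] -/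
abbrev mbarL : Ideal (DL k) := (PointBlowup.originIdeal 2 k).map (Ideal.Quotient.mk (Ideal.span {gL k}))

/-- The generators `ȳ₀, ȳ₁, ȳ₂` of `𝔪₀ ⊂ DL`. [folklore] -/
def gbarL : Fin 3 → DL k := fun i => Ideal.Quotient.mk (Ideal.span {gL k}) (X i)

/-- `ȳᵢ ∈ 𝔪₀`. [folklore] -/
theorem gbarL_mem (i : Fin 3) : gbarL k i ∈ mbarL k :=
  Ideal.mem_map_of_mem _ (Ideal.subset_span (Set.mem_range_self i))

/-- The chart rings `DL[𝔪₀/ȳⱼ]` of the inner point step. [cite: StacksProject, Tag 052Q] -/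
abbrev BchL (j : Fin 3) : Type := blowupAlgebra (mbarL k) (gbarL k j)

/-- The exceptional generator `ȳⱼ/1 ∈ DL[𝔪₀/ȳⱼ]`. [cite: StacksProject, Tag 052Q] -/
abbrev excL (j : Fin 3) : BchL k j := algebraMap (DL k) (BchL k j) (gbarL k j)

/-- The fractions `ȳᵢ/ȳⱼ ∈ DL[𝔪₀/ȳⱼ]`. [cite: StacksProject, Tag 052Q] -/
abbrev frL (j i : Fin 3) : BchL k j := blowupAlgebra.gen (mbarL k) (gbarL k j) (gbarL k i) (gbarL_mem k i)

/-- **SELF-SIMILARITY of the `y₀`-chart**: `DL ≃+* DL[𝔪₀/ȳ₀]` with `ȳ₀ ↦ ȳ₀/1` (exceptional generator), `ȳ₁ ↦ ȳ₁/ȳ₀`, `ȳ₂ ↦ ȳ₂/ȳ₀`: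
in the chart `k[y₀, s, t]` (`y₁ = y₀s`, `y₂ = y₀t`) one has `gL = y₀² · (t² + s²(1 + y₀⁴))` and the strict transform is `gL(y₀, s, t)` again.
So the strict transform of the carrier line `(ȳ₁, ȳ₂)` is the image of `cenL`, and the final line step over this chart is the landed one.
[OURS · SPECIMEN-TC⁺ α1] [cite: StacksProject, Tag 080E] -/
theorem exists_innerChart₀_equiv_track :
    ∃ ε : DL k ≃+* BchL k 0, ε (gbarL k 0) = excL k 0 ∧ ε (gbarL k 1) = frL k 0 1 ∧ ε (gbarL k 2) = frL k 0 2 := by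
  obtain ⟨θ, hθ0, hθj⟩ := SpecimenQuartic.exists_ringEquiv_pointChart k 0
  have h1 : θ (X 1) = PointBlowup.frac 2 k 0 1 := hθj 1 (by decide)
  have h2 : θ (X 2) = PointBlowup.frac 2 k 0 2 := hθj 2 (by decide)
  set G : MvPolynomial {j : Fin 3 // j ≠ 0} (MvPolynomial (Fin 3) k) :=
    X ⟨2, by decide⟩ ^ 2 + X ⟨1, by decide⟩ ^ 2 * (1 + C (X 0 ^ 4)) with hG
  have hev : blowupAlgebra.eval (MvPolynomial.X : Fin 3 → MvPolynomial (Fin 3) k) 0 G =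
      PointBlowup.frac 2 k 0 2 ^ 2 + PointBlowup.frac 2 k 0 1 ^ 2 * (1 + PointBlowup.exc 2 k 0 ^ 4) := by
    simp only [hG, map_add, map_pow, map_mul, map_one, blowupAlgebra.eval_X, blowupAlgebra.eval_C]
  have hθg : θ (gL k) = blowupAlgebra.eval (MvPolynomial.X : Fin 3 → MvPolynomial (Fin 3) k) 0 G := by
    rw [hev, gL, map_add, map_pow, h2, map_mul, map_pow, h1, map_add, map_one, map_pow, hθ0]
  have hf : algebraMap (MvPolynomial (Fin 3) k) (PointBlowup.Chart 2 k 0) (gL k) =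
      algebraMap (MvPolynomial (Fin 3) k) (PointBlowup.Chart 2 k 0) (X 0) ^ 2 *
        blowupAlgebra.eval (MvPolynomial.X : Fin 3 → MvPolynomial (Fin 3) k) 0 G := by
    rw [hev, gL, map_add, map_mul, map_pow, map_pow, map_add, map_one, map_pow, PointBlowup.algebraMap_X 2 k 0 2,
      PointBlowup.algebraMap_X 2 k 0 1]
    change _ = PointBlowup.exc 2 k 0 ^ 2 * _
    ring
  have hndvd : ¬ algebraMap (MvPolynomial (Fin 3) k) (PointBlowup.Chart 2 k 0) (X 0) ∣
      blowupAlgebra.eval (MvPolynomial.X : Fin 3 → MvPolynomial (Fin 3) k) 0 G := by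
    intro h
    have hm := (blowupAlgebra.eval_mem_span_algebraMap_iff (MvPolynomial.X : Fin 3 → MvPolynomial (Fin 3) k) 0
      (SpecimenQuartic.isQuasiRegular_X k) G).mp (Ideal.mem_span_singleton.mpr h) (Finsupp.single ⟨2, by decide⟩ 2)
    have hc : G.coeff (Finsupp.single ⟨2, by decide⟩ 2) = 1 := by
      classical
      rw [hG, coeff_add, coeff_X_pow, if_pos rfl, coeff_mul]
      -- the second summand has no `X⟨2⟩²` coefficient: every term carries `X⟨1⟩²`
      have hz : ∀ x ∈ Finset.antidiagonal (Finsupp.single (⟨2, by decide⟩ : {j : Fin 3 // j ≠ 0}) 2),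
          coeff x.1 (X ⟨1, by decide⟩ ^ 2 : MvPolynomial {j : Fin 3 // j ≠ 0} (MvPolynomial (Fin 3) k)) *
            coeff x.2 (1 + C (X 0 ^ 4)) = 0 := by
        rintro ⟨a, b⟩ hab
        rw [Finset.mem_antidiagonal] at hab
        rw [coeff_X_pow]
        split_ifs with ha
        · exfalso
          have ha' : a ⟨1, by decide⟩ = 2 := by
            have := congrArg (fun e : {j : Fin 3 // j ≠ 0} →₀ ℕ => e ⟨1, by decide⟩) ha
            simp at this
            exact this.symm
          have := congrArg (fun e : {j : Fin 3 // j ≠ 0} →₀ ℕ => e ⟨1, by decide⟩) hab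
          simp at this
          exact two_ne_zero (ha'.symm.trans this.1)
        · rw [zero_mul]
      rw [Finset.sum_eq_zero hz, add_zero]
    rw [hc] at hm
    haveI := SpecimenQuartic.isDomain_quotient_origin k
    exact ((Ideal.Quotient.isDomain_iff_prime _).mp inferInstance).ne_top ((Ideal.eq_top_iff_one _).mpr hm)
  have hmap : Ideal.map θ (Ideal.span {gL k}) =
      Ideal.span {blowupAlgebra.eval (MvPolynomial.X : Fin 3 → MvPolynomial (Fin 3) k) 0 G} := by
    rw [Ideal.map_span, Set.image_singleton]
    exact congrArg _ (congrArg _ hθg)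
  refine ⟨(Ideal.quotientEquiv _ _ θ hmap.symm).trans
    (blowupAlgebra.quotientKerMapQuotientEquiv _ _ hf (SpecimenQuartic.prime_exc k 0) hndvd), ?_, ?_, ?_⟩
  · change ((Ideal.quotientEquiv _ _ θ hmap.symm).trans
      (blowupAlgebra.quotientKerMapQuotientEquiv _ _ hf (SpecimenQuartic.prime_exc k 0) hndvd))
      (Ideal.Quotient.mk (Ideal.span {gL k}) (X 0)) = _
    rw [RingEquiv.trans_apply, Ideal.quotientEquiv_mk]
    change blowupAlgebra.mapQuotient _ _ _ (θ (X 0)) = _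
    rw [hθ0]
    exact blowupAlgebra.mapQuotient_algebraMap _ _ _ (X 0)
  · change ((Ideal.quotientEquiv _ _ θ hmap.symm).trans
      (blowupAlgebra.quotientKerMapQuotientEquiv _ _ hf (SpecimenQuartic.prime_exc k 0) hndvd))
      (Ideal.Quotient.mk (Ideal.span {gL k}) (X 1)) = _
    rw [RingEquiv.trans_apply, Ideal.quotientEquiv_mk]
    change blowupAlgebra.mapQuotient _ _ _ (θ (X 1)) = _
    rw [h1]
    exact blowupAlgebra.mapQuotient_gen _ _ _ (X 1) _
  · change ((Ideal.quotientEquiv _ _ θ hmap.symm).trans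
      (blowupAlgebra.quotientKerMapQuotientEquiv _ _ hf (SpecimenQuartic.prime_exc k 0) hndvd))
      (Ideal.Quotient.mk (Ideal.span {gL k}) (X 2)) = _
    rw [RingEquiv.trans_apply, Ideal.quotientEquiv_mk]
    change blowupAlgebra.mapQuotient _ _ _ (θ (X 2)) = _
    rw [h2]
    exact blowupAlgebra.mapQuotient_gen _ _ _ (X 2) _

end SpecimenQuarticTcPlus

end Summit.ResolutionOfSingularities.ResolutionOfSingularities.Cruxes.EquisingularLiftNat.Sections
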